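import Summits.QuantumFields.BalabanUV.T4Continuum.Support.B13TermRep
import Literature.MathematicalPhysics.QuantumFieldTheory.Dimock2011to13.UrsellTreeGraphBound

/-!
# NE5 ∕ U3 — row O1-d3: NON-VACUITY of the split binders of `B13TermRep` (activity majorant × summable combinatorial majorant)
# on leaf-08's toy indexing with a COMPATIBLE hard core — the Ursell series collapses to its one-polymer term, `TermRep` and
# the per-domain `ClassBound` FIRE through `termRep_b13_of_actBound` ∕ `classBound_b13_of_actBound`

Cell `pub-balaban`, unit `b2b-balaban-t4-ne5-formalise-leaf-04` (NE5 formalisation swarm, LEAF PROVER 04; claim table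
`t4/b2b-balaban-t4-ne5-p1/O1-CLAIM-TABLE-NE5-P1.md` row O1-d, part d3).  Summits-side new work under the LEAN PLACEMENT RULE (cell
bookkeeping; NOT a Literature module).  HONEST FRAMING: rung (B)+1 of the FINITE-VOLUME T⁴ continuum programme — NOT infinite volume,
NOT a mass gap, NOT the Clay problem, NOT a proof of NE5.  HONEST DEPENDENCY (cell line, verbatim): continuum YM on T⁴ ⇐ BetaPertH ∧
nine spine estimates (0/9 proved); BetaPertH ⇐ (D1) ∧ (D4) ∧ CAP+tail; G-an2-4 gates asym, D1 and NE2/3/4.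

WHAT THIS FILE DOES (a toy, no Bałaban object).  On `B13StepTermFamily.toyIndexing` (index `n` = the `(n+1)`-tuple of copies of ONE
polymer, localizing at every step-`k` domain of `T4InputCauchyRate.toyCarriers`) with the activity term `toyAct = exp(o + h)` and the
hard core `noInc := ⊥` (all polymers COMPATIBLE):
* `rhoT_eq_zero_of_forall_not` — for a hard core with NO incompatible pair, `ρᵀ` of every tuple with ≥ 2 members vanishes (the tree's
  tree-graph inequality `UrsellTreeGraphBound.abs_hcUrsell_le_card_treeGraphs` + `treeGraphs_eq_empty_of_split`: an edgeless graph on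
  ≥ 2 vertices carries no spanning tree — [Dimock2013] App. B *"ρ^T = 0 if the Y_j can be divided into disjoint sets"*);
* hence `coeff` vanishes off the one-polymer index, the combinatorial majorant `actMajorant` is supported on `{0}` with value `A`, is
  summable with `tsum = A` (`summable_actMajorant_toy`, `tsum_actMajorant_toy`), and the toy's `out` IS `exp(o + h)` (`out_toy_eq`);
* with the activity majorant `A ≡ e²` on the ball class of radii `(1, 1)` about `0` (`‖exp(o + h)‖ ≤ e^{‖o‖+‖h‖} ≤ e²`), the split END
  points of `B13TermRep` FIRE for the step model `toyStep` (`T4InputCauchyRateData.toyModel` with `Out := out toyIndexing noInc toyAct`):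
  `toy_termRep` (`TermRep`) and `toy_classBound` (`ClassBound … 0 (exp 2)`) — so the hypothesis lists of `termRep_b13_of_actBound` ∕
  `classBound_b13_of_actBound` are JOINTLY INHABITED by a model whose output is a genuine (if collapsing) Ursell series.
0 sorry; no new axioms.
-/

noncomputable section

open scoped BigOperators
open Metric

namespace Summit.QuantumFields.BalabanUV.T4Continuum.B13TermRepWitness

open Literature.MathematicalPhysics.QuantumFieldTheory.Balaban1983to89.T4OutputRate (Carriers)
open Literature.MathematicalPhysics.QuantumFieldTheory.Balaban1983to89.T4InputCauchyRate (toyCarriers)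
open Literature.MathematicalPhysics.QuantumFieldTheory.Balaban1983to89.T4InputCauchyRateData (StepModel toyModel)
open Literature.MathematicalPhysics.QuantumFieldTheory.Balaban1983to89.T4InputCauchyRateSpecies (ClassBound ballClass toyCtr)
open Literature.MathematicalPhysics.QuantumFieldTheory.Balaban1983to89.T4InputCauchyRateTermwise (TermRep)
open Literature.Probability.LatticeModels (hcUrsell)
open Literature.MathematicalPhysics.QuantumFieldTheory.Dimock2011to13.UrsellTreeGraphBound
  (abs_hcUrsell_le_card_treeGraphs treeGraphs_eq_empty_of_split)
open Summit.QuantumFields.BalabanUV.T4Continuum.B13StepTermFamily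
  (TermIndexing rhoT rhoT_one coeff term out out_eq_tsum term_single toyIndexing toyAct)
open Summit.QuantumFields.BalabanUV.T4Continuum.B13TermRep
  (actMajorant actMajorant_of_rel actMajorant_of_not_rel summable_term_of_actBound termRep_b13_of_actBound
    classBound_b13_of_actBound)

/-! ## §1 A hard core with no incompatible pair kills every Ursell coefficient of a tuple with at least two members -/

section NoCore

variable {P : Type*} (inc : P → P → Prop) [DecidableRel inc]

/-- [folklore] **`ρᵀ = 0` WITHOUT INCOMPATIBILITIES**: if no two polymers are incompatible, the Ursell coefficient of every ordered
tuple with at least two members vanishes — the tuple's incompatibility graph is edgeless, so it carries no spanning tree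
(`treeGraphs_eq_empty_of_split` with the split `{0} ∣ rest`) and `|ρᵀ| ≤ #trees = 0` (`abs_hcUrsell_le_card_treeGraphs`). -/
theorem rhoT_eq_zero_of_forall_not (hinc : ∀ a b, ¬ inc a b) {n : ℕ} (Z : Fin (n + 2) → P) : rhoT inc Z = 0 := by
  unfold rhoT
  have h := abs_hcUrsell_le_card_treeGraphs (H := fun m m' : Fin (n + 2) => inc (Z m) (Z m'))
    (fun a b hab => (hinc _ _ hab).elim) Finset.univ (v := 0) (Finset.mem_univ _)
  rw [treeGraphs_eq_empty_of_split (A := {0}) ⟨0, by simp⟩ ⟨1, by simp⟩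
    (fun a _ _ b _ _ => ⟨hinc _ _, hinc _ _⟩) (Finset.mem_univ _), Finset.card_empty, Nat.cast_zero] at h
  exact abs_nonpos_iff.1 h

end NoCore

/-! ## §2 The toy: one polymer, compatible hard core, activity `exp(o + h)` -/

/-- [folklore] The COMPATIBLE hard core on the one-polymer type: no pair is incompatible. -/
def noInc : Unit → Unit → Prop := fun _ _ => False

/-- [folklore] It is decidable. -/
instance : DecidableRel noInc := fun _ _ => instDecidableFalse

/-- [folklore] Off the one-polymer index the toy's coefficient vanishes (`ρᵀ` of ≥ 2 compatible copies is `0`). -/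
theorem coeff_toy_succ (n : ℕ) : coeff toyIndexing noInc (n + 1) = 0 := by
  show ((Nat.factorial (n + 1 + 1) : ℂ))⁻¹ * (rhoT noInc (fun _ : Fin (n + 2) => ()) : ℂ) = 0
  rw [rhoT_eq_zero_of_forall_not noInc (fun _ _ h => h) (n := n) (fun _ => ()), Int.cast_zero, mul_zero]

/-- [folklore] At the one-polymer index the toy's coefficient is `1` (`ρᵀ(Z) = 1`, `1! = 1`). -/
theorem coeff_toy_zero : coeff toyIndexing noInc 0 = 1 := by
  show ((Nat.factorial (0 + 1) : ℂ))⁻¹ * (rhoT noInc (fun _ : Fin 1 => ()) : ℂ) = 1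
  rw [rhoT_one]
  simp

/-- [folklore] The toy's combinatorial majorant vanishes off the one-polymer index. -/
theorem actMajorant_toy_succ (A : Unit → Unit → ℝ) (k : ℕ) (X : toyCarriers.Dom) (n : ℕ) :
    actMajorant toyIndexing noInc A k X (n + 1) = 0 := by
  by_cases h : toyIndexing.Rel k (n + 1) X
  · rw [actMajorant_of_rel h, coeff_toy_succ, norm_zero, zero_mul]
  · rw [actMajorant_of_not_rel h]

/-- [folklore] At the one-polymer index of a step-`k` domain the toy's combinatorial majorant is the activity majorant itself. -/
theorem actMajorant_toy_zero (A : Unit → Unit → ℝ) {k : ℕ} {X : toyCarriers.Dom} (hX : toyCarriers.scale X = k) :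
    actMajorant toyIndexing noInc A k X 0 = A () () := by
  rw [actMajorant_of_rel (show toyIndexing.Rel k 0 X from hX), coeff_toy_zero, norm_one, one_mul]
  exact Fin.prod_univ_one _

/-- [folklore] The toy's combinatorial majorant is supported on `{0}`, hence SUMMABLE — the [26]-shape binder is inhabited. -/
theorem summable_actMajorant_toy (A : Unit → Unit → ℝ) (k : ℕ) (X : toyCarriers.Dom) :
    Summable (actMajorant toyIndexing noInc A k X) := by
  refine summable_of_ne_finset_zero (s := {0}) fun i hi => ?_
  have hi0 : i ≠ 0 := by simpa using hi
  obtain ⟨n, rfl⟩ : ∃ n, i = n + 1 := ⟨i - 1, by omega⟩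
  exact actMajorant_toy_succ A k X n

/-- [folklore] … with sum `A` at step-`k` domains. -/
theorem tsum_actMajorant_toy (A : Unit → Unit → ℝ) {k : ℕ} {X : toyCarriers.Dom} (hX : toyCarriers.scale X = k) :
    ∑' i, actMajorant toyIndexing noInc A k X i = A () () := by
  rw [tsum_eq_single 0 fun i hi => ?_, actMajorant_toy_zero A hX]
  obtain ⟨n, rfl⟩ : ∃ n, i = n + 1 := ⟨i - 1, by omega⟩
  exact actMajorant_toy_succ A k X n

/-- [folklore] The toy's Ursell terms vanish off the one-polymer index … -/
theorem term_toy_succ (k : ℕ) (o h : ℂ) (X : toyCarriers.Dom) (n : ℕ) : term toyIndexing noInc toyAct k (n + 1) o h X = 0 := by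
  have hle := B13TermRep.norm_term_le_actMajorant (𝒯 := toyIndexing) (inc := noInc) (act := toyAct)
    (A := fun _ _ => ‖Complex.exp (o + h)‖) (k := k) (i := n + 1) (o := o) (h := h) (X := X) (fun _ _ => le_rfl)
  rw [actMajorant_toy_succ] at hle
  exact norm_le_zero_iff.1 hle

/-- [folklore] … and at it equal the activity `exp(o + h)` (`term_single`). -/
theorem term_toy_zero {k : ℕ} {X : toyCarriers.Dom} (hX : toyCarriers.scale X = k) (o h : ℂ) :
    term toyIndexing noInc toyAct k 0 o h X = Complex.exp (o + h) := by
  rw [term_single toyIndexing noInc toyAct (i := 0) hX rfl]; exact Fin.prod_univ_one _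

/-- [folklore] **The toy's ordered Ursell series COMPUTES**: `out k o h X = exp(o + h)` at step-`k` domains (only the one-polymer
term survives a compatible hard core). -/
theorem out_toy_eq {k : ℕ} {X : toyCarriers.Dom} (hX : toyCarriers.scale X = k) (o h : ℂ) :
    out toyIndexing noInc toyAct k o h X = Complex.exp (o + h) := by
  rw [out_eq_tsum, tsum_eq_single 0 fun i hi => ?_, term_toy_zero hX]
  obtain ⟨n, rfl⟩ : ∃ n, i = n + 1 := ⟨i - 1, by omega⟩
  exact term_toy_succ k o h X n

/-! ## §3 The split END points of `B13TermRep` fire on the toy step model -/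

/-- [folklore] THE TOY STEP MODEL: `T4InputCauchyRateData.toyModel` (unit margins, the toy runs' data) with its output REPLACED by the
ordered Ursell series `out toyIndexing noInc toyAct`. -/
def toyStep : StepModel toyCarriers ℂ ℂ := { toyModel with Out := out toyIndexing noInc toyAct }

/-- [folklore] The activity majorant `e²` on the ball class of radii `(1, 1)` about the origin: `‖exp(o + h)‖ = e^{Re(o+h)} ≤ e^{‖o‖+‖h‖}
≤ e²`. -/
theorem norm_toyAct_le {q : ℂ × ℂ} (h1 : ‖q.1‖ ≤ 1) (h2 : ‖q.2‖ ≤ 1) : ‖toyAct () () q.1 q.2‖ ≤ Real.exp 2 := by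
  show ‖Complex.exp (q.1 + q.2)‖ ≤ Real.exp 2
  rw [Complex.norm_exp]
  refine Real.exp_le_exp.2 ?_
  calc (q.1 + q.2).re ≤ ‖q.1 + q.2‖ := Complex.re_le_norm _
    _ ≤ ‖q.1‖ + ‖q.2‖ := norm_add_le _ _
    _ ≤ 2 := by linarith

/-- [folklore] Class points of the ball class `(1, 1)` about `toyCtr = 0` have both coordinates of norm at most `1`. -/
theorem norm_le_of_mem_ballClass {k : ℕ} {g : ℕ → ℝ} {U : toyCarriers.BgB} {q : ℂ × ℂ}
    (hq : q ∈ ballClass toyCtr (fun _ => 1) (fun _ => 1) k g U) : ‖q.1‖ ≤ 1 ∧ ‖q.2‖ ≤ 1 := by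
  obtain ⟨hq1, hq2⟩ := Set.mem_prod.1 hq
  rw [mem_closedBall, dist_eq_norm] at hq1 hq2
  exact ⟨by simpa [toyCtr] using hq1, by simpa [toyCtr] using hq2⟩

/-- [folklore] **`TermRep` FIRES ON THE TOY through the split END point** `termRep_b13_of_actBound`: output = series by `rfl`,
activity majorant `e²` on the class, summable combinatorial majorant. -/
theorem toy_termRep : TermRep toyStep (ballClass toyCtr (fun _ => 1) fun _ => 1) (term toyIndexing noInc toyAct) Set.univ :=
  termRep_b13_of_actBound toyIndexing noInc toyAct (M := toyStep) (fun _ _ _ _ => rfl)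
    (A := fun _ _ _ _ _ => Real.exp 2)
    (fun _ _ _ _ q hq _ _ _ _ _ => by
      obtain ⟨h1, h2⟩ := norm_le_of_mem_ballClass hq
      exact norm_toyAct_le h1 h2)
    fun k _ _ _ X _ => summable_actMajorant_toy _ k X

/-- [folklore] **The per-domain `ClassBound` FIRES ON THE TOY through** `classBound_b13_of_actBound`, with class constant `e²` and
decay rate `0` (the toy carriers have tree length `0`). -/
theorem toy_classBound : ClassBound toyStep (ballClass toyCtr (fun _ => 1) fun _ => 1) Set.univ 0 (Real.exp 2) :=
  classBound_b13_of_actBound (𝒯 := toyIndexing) (inc := noInc) (act := toyAct) (M := toyStep) (fun _ _ _ _ => rfl)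
    (A := fun _ _ _ _ _ => Real.exp 2)
    (fun _ _ _ _ q hq _ _ _ _ _ => by
      obtain ⟨h1, h2⟩ := norm_le_of_mem_ballClass hq
      exact norm_toyAct_le h1 h2)
    fun k _ _ _ X hX => ⟨summable_actMajorant_toy _ k X, by
      rw [tsum_actMajorant_toy _ hX, zero_mul, neg_zero, Real.exp_zero, mul_one]⟩

/-- [folklore] Consistency: on the class the toy model's output is `exp(o + h)`, bounded by the class constant. -/
example {k : ℕ} {X : toyCarriers.Dom} (hX : toyCarriers.scale X = k) (o h : ℂ) :
    toyStep.Out k o h X = Complex.exp (o + h) := out_toy_eq hX o h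

end Summit.QuantumFields.BalabanUV.T4Continuum.B13TermRepWitness

end
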